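import Mathlib
import Summits.ValiantsHypothesis.ValiantsHypothesis.Theorems.LacunarySymmetroidMatrixDescartesDefiniteMomentsDescartes
import Summits.ValiantsHypothesis.ValiantsHypothesis.Theorems.LacunarySymmetroidMatrixDescartesSignWordLawMDR

/-!
# `MatrixDescartes` (stmt-ValiantsHypothesis-18050) — the DEFINITE-MOMENTS LAW, VII: real-zero counts and the crux's
# inequality on the sector at every fat format

HONEST FRAMING.  Cell `pub-symmetroid`, seat `val-sym-mdr-p2` (gen 14); helper file `--supports` the crux
`Theses.LacunarySymmetroid.MatrixDescartes`, NO closure claim.  Crux-currency corollaries (all real zeros; the inequality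
`Z^q ≤ 2^{K⌊log₂K⌋}` at all sizes `m ≤ 2^{(⌊log₂K⌋+c)^c}`) of the definite-moments law `…DefiniteMoments` /
`…DefiniteMomentsDescartes` — `MatrixDescartes` RESTRICTED TO THIS FORMAT FAMILY, nothing outside it; nothing on
`stub_twoSided`, `DoorA26`/`DoorA34`, registers, or `VP ≠ VNP`.

CONTENT.  `definiteMoments_realRoots_le`: if `F(X) = ∑ₗ X^{dₗ} Sₗ` (real symmetric `m × m` letters, `K` terms) has
Rayleigh budget `V` saturated by `V + 1` alternating definite moments, and the reflected pencil `F(−X) = ∑ₗ X^{dₗ}((−1)^{dₗ}Sₗ)`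
has budget `V'` saturated by `V' + 1` such moments, then `det F` has at most `V·m + V'·m + 1` distinct REAL zeros
(positive zeros of `F`, of `F(−X)`, and the origin: tree `stub_negRoots`).  `alternatingMoments_realRoots_le`: with
`K ≤ V + 1`, `K ≤ V' + 1` the budgets are Descartes' and drop out.  `definiteMoments_mdr`: for `V, V' ≤ K` the count is
`≤ 2Km + 1`, absorbed by `Census.fatFormat_absorb` — the crux inequality on the sector at every admissible size.
[folklore]; axioms `propext`, `Classical.choice`, `Quot.sound`.
-/

-- layout Summits/ValiantsHypothesis/ValiantsHypothesis forces the duplicated namespace component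
set_option linter.dupNamespace false

namespace Summit.ValiantsHypothesis.ValiantsHypothesis.Theorems.LacunarySymmetroidMatrixDescartes

open Polynomial Matrix Finset
open scoped BigOperators

namespace DefiniteMoments

/-- **Real zeros under definite moments on both half-lines.**  `F = ∑ₗ X^{dₗ} Sₗ` with real symmetric `m × m` letters:
if the Rayleigh forms of `F` have at most `V` positive zeros each and `F` takes alternating definite values at
`0 < a₀ < ⋯ < a_V`, and the reflected letters `(−1)^{dₗ} Sₗ` satisfy the same with `V'` and `a'`, then `det F` has at
most `V·m + V'·m + 1` distinct real zeros. [folklore] -/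
theorem definiteMoments_realRoots_le (K m : ℕ) (d : Fin K → ℕ) (S : Fin K → Matrix (Fin m) (Fin m) ℝ)
    (hS : ∀ l, (S l).IsSymm) (V V' : ℕ)
    (a : Fin (V + 1) → ℝ) (ha : StrictMono a) (ha0 : 0 < a 0) (σ : ℝ)
    (hdef : ∀ (j : Fin (V + 1)) (v : Fin m → ℝ), v ≠ 0 →
      0 < σ * (-1) ^ (j : ℕ) * (v ⬝ᵥ ((∑ l, a j ^ d l • S l) *ᵥ v)))
    (hbudget : ∀ v : Fin m → ℝ, v ≠ 0 → ∀ T : Finset ℝ,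
      (∀ r ∈ T, 0 < r ∧ v ⬝ᵥ ((∑ l, r ^ d l • S l) *ᵥ v) = 0) → T.card ≤ V)
    (a' : Fin (V' + 1) → ℝ) (ha' : StrictMono a') (ha'0 : 0 < a' 0) (σ' : ℝ)
    (hdef' : ∀ (j : Fin (V' + 1)) (v : Fin m → ℝ), v ≠ 0 →
      0 < σ' * (-1) ^ (j : ℕ) * (v ⬝ᵥ ((∑ l, a' j ^ d l • (((-1 : ℝ) ^ d l) • S l)) *ᵥ v)))
    (hbudget' : ∀ v : Fin m → ℝ, v ≠ 0 → ∀ T : Finset ℝ,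
      (∀ r ∈ T, 0 < r ∧ v ⬝ᵥ ((∑ l, r ^ d l • (((-1 : ℝ) ^ d l) • S l)) *ᵥ v) = 0) → T.card ≤ V') :
    (Matrix.det (∑ l, ((Polynomial.X : Polynomial ℝ) ^ d l) • (S l).map Polynomial.C)
      ).roots.toFinset.card ≤ V * m + V' * m + 1 := by
  have h1 := card_posRoots_le_of_definiteMoments d S hS V a ha ha0 σ hdef hbudget
  have h2 := card_posRoots_le_of_definiteMoments d (fun l => ((-1 : ℝ) ^ d l) • S l)
    (fun l => (hS l).smul _) V' a' ha' ha'0 σ' hdef' hbudget'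
  have h3 := stub_negRoots K m d S
  rw [Fintype.card_fin] at h1 h2
  omega

/-- **Real zeros under `K` alternating definite moments on both half-lines** (any real symmetric letters): if `F` takes
alternating definite values at `V + 1 ≥ K` positive scales and `F(−X)` at `V' + 1 ≥ K` positive scales, then `det F` has
at most `V·m + V'·m + 1` distinct real zeros — for `V = V' = K − 1`, `2(K−1)m + 1`. [folklore] -/
theorem alternatingMoments_realRoots_le (K m : ℕ) (d : Fin K → ℕ) (S : Fin K → Matrix (Fin m) (Fin m) ℝ)
    (hS : ∀ l, (S l).IsSymm) (V V' : ℕ) (hV : K ≤ V + 1) (hV' : K ≤ V' + 1)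
    (a : Fin (V + 1) → ℝ) (ha : StrictMono a) (ha0 : 0 < a 0) (σ : ℝ)
    (hdef : ∀ (j : Fin (V + 1)) (v : Fin m → ℝ), v ≠ 0 →
      0 < σ * (-1) ^ (j : ℕ) * (v ⬝ᵥ ((∑ l, a j ^ d l • S l) *ᵥ v)))
    (a' : Fin (V' + 1) → ℝ) (ha' : StrictMono a') (ha'0 : 0 < a' 0) (σ' : ℝ)
    (hdef' : ∀ (j : Fin (V' + 1)) (v : Fin m → ℝ), v ≠ 0 →
      0 < σ' * (-1) ^ (j : ℕ) * (v ⬝ᵥ ((∑ l, a' j ^ d l • (((-1 : ℝ) ^ d l) • S l)) *ᵥ v))) :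
    (Matrix.det (∑ l, ((Polynomial.X : Polynomial ℝ) ^ d l) • (S l).map Polynomial.C)
      ).roots.toFinset.card ≤ V * m + V' * m + 1 := by
  have h1 := card_posRoots_le_of_alternatingMoments d S hS V (by rw [Fintype.card_fin]; exact hV) a ha ha0 σ hdef
  have h2 := card_posRoots_le_of_alternatingMoments d (fun l => ((-1 : ℝ) ^ d l) • S l)
    (fun l => (hS l).smul _) V' (by rw [Fintype.card_fin]; exact hV') a' ha' ha'0 σ' hdef'
  have h3 := stub_negRoots K m d S
  rw [Fintype.card_fin] at h1 h2
  omega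

/-- **The crux's inequality on the definite-moments sector, at every admissible size.**  For all `c, q` there is `K₀`
such that for all `K ≥ K₀`, all `m ≤ 2^((⌊log₂K⌋+c)^c)`, all exponents and all real symmetric `m × m` letters whose
pencil `F` has Rayleigh budget `V ≤ K` saturated by `V + 1` alternating definite moments, and whose reflection `F(−X)` has
budget `V' ≤ K` saturated likewise, the number `Z` of distinct real zeros of `det F` satisfies `Z^q ≤ 2^(K⌊log₂K⌋)` —
`MatrixDescartes` restricted to this format family, fat formats included; nothing is claimed outside it. [folklore] -/
theorem definiteMoments_mdr (c q : ℕ) : ∃ K₀ : ℕ, ∀ K m : ℕ, K₀ ≤ K → m ≤ 2 ^ ((Nat.log 2 K + c) ^ c) →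
    ∀ (d : Fin K → ℕ) (S : Fin K → Matrix (Fin m) (Fin m) ℝ), (∀ l, (S l).IsSymm) →
    ∀ (V V' : ℕ), V ≤ K → V' ≤ K →
    ∀ (a : Fin (V + 1) → ℝ), StrictMono a → 0 < a 0 → ∀ (σ : ℝ),
    (∀ (j : Fin (V + 1)) (v : Fin m → ℝ), v ≠ 0 →
      0 < σ * (-1) ^ (j : ℕ) * (v ⬝ᵥ ((∑ l, a j ^ d l • S l) *ᵥ v))) →
    (∀ v : Fin m → ℝ, v ≠ 0 → ∀ T : Finset ℝ,
      (∀ r ∈ T, 0 < r ∧ v ⬝ᵥ ((∑ l, r ^ d l • S l) *ᵥ v) = 0) → T.card ≤ V) →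
    ∀ (a' : Fin (V' + 1) → ℝ), StrictMono a' → 0 < a' 0 → ∀ (σ' : ℝ),
    (∀ (j : Fin (V' + 1)) (v : Fin m → ℝ), v ≠ 0 →
      0 < σ' * (-1) ^ (j : ℕ) * (v ⬝ᵥ ((∑ l, a' j ^ d l • (((-1 : ℝ) ^ d l) • S l)) *ᵥ v))) →
    (∀ v : Fin m → ℝ, v ≠ 0 → ∀ T : Finset ℝ,
      (∀ r ∈ T, 0 < r ∧ v ⬝ᵥ ((∑ l, r ^ d l • (((-1 : ℝ) ^ d l) • S l)) *ᵥ v) = 0) → T.card ≤ V') →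
    (Matrix.det (∑ l, ((Polynomial.X : Polynomial ℝ) ^ d l) • (S l).map Polynomial.C)
      ).roots.toFinset.card ^ q ≤ 2 ^ (K * Nat.log 2 K) := by
  obtain ⟨K₀, hK₀⟩ := Census.fatFormat_absorb 1 c q
  refine ⟨K₀, fun K m hK hm d S hS V V' hV hV' a ha ha0 σ hdef hbudget a' ha' ha'0 σ' hdef' hbudget' =>
    hK₀ K m _ hK hm ?_⟩
  have hZ := definiteMoments_realRoots_le K m d S hS V V' a ha ha0 σ hdef hbudget a' ha' ha'0 σ' hdef' hbudget'
  have h1 : V * m ≤ K * m := Nat.mul_le_mul_right m hV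
  have h2 : V' * m ≤ K * m := Nat.mul_le_mul_right m hV'
  have h4 : V * m + V' * m + 1 ≤ 2 ^ 1 * (m + 1) * (K + 1) := by nlinarith
  exact hZ.trans h4

end DefiniteMoments

end Summit.ValiantsHypothesis.ValiantsHypothesis.Theorems.LacunarySymmetroidMatrixDescartes
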